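import Literature.Analysis.Complex.RiemannSphereDbar
import Literature.Analysis.Complex.RiemannSphereDbarRightInverse
import Literature.Analysis.Complex.RiemannSphereDbarKernel
import Literature.Analysis.Complex.RiemannSphereSectionOperators
import Literature.Analysis.Complex.RiemannSphereDbarInequalityDichotomy
import Literature.Analysis.Calculus.BorderedCompactPerturbation
import Mathlib.LinearAlgebra.Complex.FiniteDimensional
import HarnessLib

/-!
# Automatic transversality for `∂̄ + A` on functions over the Riemann sphere

Layer B5 of the analytic core of the Hofer–Lizan–Sikorav local foliation theorem (Wendl 2018,
Thm. 2.46 with `g = 0`, `c₁(N) = 0`; lead of crux `WitnessCharge`, summit `SmoothPoincare4`).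
Let `A` be a smooth real-linear zeroth-order operator from functions on `S²` to `(0,1)`-forms
(coefficient fields `a₀, a₁ : ℂ → (ℂ →L[ℝ] ℂ)` in the two charts, with the clutching of
`Hom(𝒪, Λ⁰¹)`), acting between the Hölder section spaces
`𝓗¹ₖ := holderSections ℂ 1 k r` (functions) and `𝓗⁰ₖ := holderSections ℂ (dbarClutch 1) k r`
(`(0,1)`-forms), and fix `z₀` with `‖z₀‖ < 2`. THEN

  `f ↦ (∂̄ f + A f, f(z₀)) : 𝓗¹ₖ₊₁ → 𝓗⁰ₖ × ℂ` is a linear isomorphism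

(`bijective_dbar_add_formMul_prod_eval`), i.e. `∂̄ + A` is onto with a 2-dimensional kernel on
which evaluation at a point is an isomorphism onto `ℂ`. Proof — the bordered Riesz lemma
`bijective_prod_of_isCompactOperator` (BorderedCompactPerturbation.lean) with:

* `hD`: `∂̄` restricted to `{f(z₀) = 0}` is bijective onto `𝓗⁰ₖ` — injective since `ker ∂̄` is
  the constants (`eq_const_of_dbar_eq_zero_one`), onto by the Dolbeault right inverse
  (`exists_dbar_rightInverse_one`) corrected by a constant (`bijective_dbarOne_ker_eval`);
* `hA`: `A` factors through the compact inclusion `𝓗¹ₖ₊₁ → 𝓗¹ₖ`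
  (`isCompactOperator_mulSec_comp_inclCLM`);
* `hinj`: a kernel element of `∂̄ + A` vanishing at `z₀` vanishes identically — it is `C^∞` by
  bootstrapping with the right inverse at every level (`contDiff_sec_of_chart_eq`)
  and satisfies the Cauchy–Riemann inequality `‖∂̄f‖ ≤ M ‖f‖` in both charts, so the similarity
  principle on the sphere (`zero_or_forall_ne_zero_of_dbar_le`, `c₁ = 0`) makes it identically
  zero or nowhere zero.

## References

* C. Wendl, *Holomorphic Curves in Low Dimensions*, LNM 2216 (2018), Thm. 2.44, Thm. 2.46,
  Prop. 2.47. [Wendl2018]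
* H. Hofer, V. Lizan, J.-C. Sikorav, *On genericity for holomorphic curves in four-dimensional
  almost-complex manifolds*, J. Geom. Anal. 7 (1997), Thm. 1. [HoferLizanSikorav1997]
-/

noncomputable section

open Set Filter Metric Function
open scoped Topology NNReal ContDiff

namespace Literature.Analysis.Complex

namespace RiemannSphere

open Literature.Analysis.FunctionSpaces

variable {k : ℕ} {r : ℝ≥0}

/-- The pair of pieces of a member, at an explicit Hölder order. -/
local notation "⇊[" j "]" p => (p : ContDiffHolderFunction ℂ ℂ j r × ContDiffHolderFunction ℂ ℂ j r)

/-! ### Representatives of the zero member and of differences -/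

/-- The `z`-representative of the zero pair vanishes. [folklore] -/
theorem sec₀_zero_pair (τ : ℂ → ℂ) (z : ℂ) :
    sec₀ τ ((0 : ContDiffHolderFunction ℂ ℂ k r × ContDiffHolderFunction ℂ ℂ k r)) z = 0 := by
  unfold sec₀
  split_ifs <;> simp

/-- The `w`-representative of the zero pair vanishes. [folklore] -/
theorem sec₁_zero_pair (τ : ℂ → ℂ) (w : ℂ) :
    sec₁ τ ((0 : ContDiffHolderFunction ℂ ℂ k r × ContDiffHolderFunction ℂ ℂ k r)) w = 0 := by
  unfold sec₁
  split_ifs <;> simp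

/-! ### The setting -/

section Setting

/-- Clutching compatibility of a zeroth-order coefficient field from functions (`τ = 1`) to
`(0,1)`-forms (`τ' = dbarClutch 1`). [cite: Wendl2018, §2.3] -/
def IsFormCoeff (a₀ a₁ : ℂ → ℂ →L[ℝ] ℂ) : Prop :=
  ∀ w : ℂ, w ≠ 0 → ∀ x : ℂ, a₁ w ((1 : ℂ → ℂ) w • x) = dbarClutch 1 w • a₀ w⁻¹ x

variable (a₀ a₁ : ℂ → ℂ →L[ℝ] ℂ) (ha₀ : ContDiff ℝ ∞ a₀) (ha₁ : ContDiff ℝ ∞ a₁)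
  (hcl : IsFormCoeff a₀ a₁)

/-- The zeroth-order operator `A : 𝓗¹ₖ → 𝓗⁰ₖ` of the coefficient field. [cite: Wendl2018, §2.3] -/
def formMul (hr : r ≤ 1) (k : ℕ) :
    holderSections ℂ (1 : ℂ → ℂ) k r →L[ℝ] holderSections ℂ (dbarClutch 1) k r :=
  mulSec one_clutch_ne_zero (contDiffOn_real_of_differentiableOn differentiableOn_one_clutch)
    (dbarClutch_ne_zero_of one_clutch_ne_zero) hr a₀ a₁ ha₀ ha₁ hcl

/-- The operator `∂̄ : 𝓗¹ₖ₊₁ → 𝓗⁰ₖ`. [cite: Wendl2018, §2.3] -/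
def dbarOne (hr : r ≤ 1) (k : ℕ) :
    holderSections ℂ (1 : ℂ → ℂ) (k + 1) r →L[ℝ] holderSections ℂ (dbarClutch 1) k r :=
  dbarSec one_clutch_ne_zero differentiableOn_one_clutch hr

end Setting

/-! ### `∂̄` restricted to `{f(z₀) = 0}` is bijective -/

section DbarBlock

/-- Chartwise characterisation of `dbarOne u = η`. [folklore] -/
theorem dbarOne_eq_iff (hr1 : r < 1) (u : holderSections ℂ (1 : ℂ → ℂ) (k + 1) r)
    (η : holderSections ℂ (dbarClutch 1) k r) :
    dbarOne hr1.le k u = η ↔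
      (∀ z : ℂ, dbarAlong 1 (sec₀ (1 : ℂ → ℂ) (⇊[k + 1] u)) z = sec₀ (dbarClutch 1) (⇊[k] η) z) ∧
      (∀ w : ℂ, dbarAlong 1 (sec₁ (1 : ℂ → ℂ) (⇊[k + 1] u)) w = sec₁ (dbarClutch 1) (⇊[k] η) w) := by
  constructor
  · rintro rfl
    exact ⟨fun z => (sec₀_dbarSec u z).symm, fun w => (sec₁_dbarSec u w).symm⟩
  · rintro ⟨h₀, h₁⟩
    refine ext_of_sec₀_sec₁ (dbarClutch_ne_zero_of one_clutch_ne_zero) (fun z _ => ?_) (fun w _ => ?_)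
    · rw [dbarOne, sec₀_dbarSec, h₀]
    · rw [dbarOne, sec₁_dbarSec, h₁]

/-- A member of `𝓗¹` whose `z`-representative vanishes identically is zero. [folklore] -/
theorem eq_zero_of_sec₀_eq_zero (u : holderSections ℂ (1 : ℂ → ℂ) k r)
    (h : ∀ z : ℂ, sec₀ (1 : ℂ → ℂ) (⇊[k] u) z = 0) : u = 0 := by
  have h₁ : ∀ w : ℂ, sec₁ (1 : ℂ → ℂ) (⇊[k] u) w = 0 := by
    have hne : ∀ w : ℂ, w ≠ 0 → sec₁ (1 : ℂ → ℂ) (⇊[k] u) w = 0 := fun w hw => by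
      rw [sec₁_eq_smul_sec₀ u.2 one_clutch_ne_zero hw, h, smul_zero]
    intro w
    by_cases hw : w = 0
    · -- continuity at `0`
      have hc : Continuous (sec₁ (1 : ℂ → ℂ) (⇊[k] u)) :=
        (contDiff_sec₁ u.2 (contDiffOn_real_of_differentiableOn differentiableOn_one_clutch)).continuous
      have hlim : Tendsto (sec₁ (1 : ℂ → ℂ) (⇊[k] u)) (𝓝[≠] 0) (𝓝 (sec₁ (1 : ℂ → ℂ) (⇊[k] u) 0)) :=
        (hc.tendsto 0).mono_left nhdsWithin_le_nhds
      have hlim' : Tendsto (sec₁ (1 : ℂ → ℂ) (⇊[k] u)) (𝓝[≠] 0) (𝓝 0) :=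
        tendsto_const_nhds.congr' (eventually_nhdsWithin_of_forall fun w hw => (hne w hw).symm)
      rw [hw]
      exact tendsto_nhds_unique hlim hlim'
    · exact hne w hw
  have h0 : ∀ z : ℂ, sec₀ (1 : ℂ → ℂ) (⇊[k] (0 : holderSections ℂ (1 : ℂ → ℂ) k r)) z = 0 :=
    fun z => sec₀_zero_pair 1 z
  have h0' : ∀ w : ℂ, sec₁ (1 : ℂ → ℂ) (⇊[k] (0 : holderSections ℂ (1 : ℂ → ℂ) k r)) w = 0 :=
    fun w => sec₁_zero_pair 1 w
  exact ext_of_sec₀_sec₁ one_clutch_ne_zero (fun z _ => by rw [h z, h0 z])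
    (fun w _ => by rw [h₁ w, h0' w])

/-- The constant member `const c` of `𝓗¹ₖ`, with representatives `≡ c` and `∂̄ = 0`.
[folklore] -/
theorem exists_const (k : ℕ) (hr : r ≤ 1) (c : ℂ) :
    ∃ p : holderSections ℂ (1 : ℂ → ℂ) k r,
      (∀ z : ℂ, sec₀ (1 : ℂ → ℂ) (⇊[k] p) z = c) ∧ (∀ w : ℂ, sec₁ (1 : ℂ → ℂ) (⇊[k] p) w = c) ∧
      (∀ z : ℂ, dbarAlong 1 (sec₀ (1 : ℂ → ℂ) (⇊[k] p)) z = 0) ∧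
      (∀ w : ℂ, dbarAlong 1 (sec₁ (1 : ℂ → ℂ) (⇊[k] p)) w = 0) :=
  const_mem_one k hr c

/-- **`∂̄` restricted to `{f(z₀) = 0}` is a bijection onto the `(0,1)`-forms** (`‖z₀‖ < 2`):
Dolbeault `H^{0,1}(ℂℙ¹) = 0`, `H⁰(𝒪) = ℂ`, in Hölder classes. [cite: Wendl2018, Thm. 2.44] -/
theorem bijective_dbarOne_ker_eval (hr0 : 0 < r) (hr1 : r < 1) (k : ℕ) {z₀ : ℂ} (hz₀ : ‖z₀‖ < 2) :
    Bijective fun x : (eval₀CLM (F := ℂ) (1 : ℂ → ℂ) (k + 1) r z₀).ker => dbarOne hr1.le k (x : _) := by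
  constructor
  · -- injective: kernel of `∂̄` = constants, and the constant vanishes at `z₀`
    intro x y hxy
    apply Subtype.ext
    have hd : dbarOne hr1.le k ((x : holderSections ℂ (1 : ℂ → ℂ) (k + 1) r) - y) = 0 := by
      rw [map_sub, sub_eq_zero]; exact hxy
    set d : holderSections ℂ (1 : ℂ → ℂ) (k + 1) r := (x : _) - y with hd_def
    obtain ⟨h₀, h₁⟩ := (dbarOne_eq_iff hr1 d 0).1 hd
    have h₀' : ∀ z, dbarAlong 1 (sec₀ (1 : ℂ → ℂ) (⇊[k + 1] d)) z = 0 := fun z => by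
      rw [h₀ z, Submodule.coe_zero, sec₀_zero_pair]
    have h₁' : ∀ w, dbarAlong 1 (sec₁ (1 : ℂ → ℂ) (⇊[k + 1] d)) w = 0 := fun w => by
      rw [h₁ w, Submodule.coe_zero, sec₁_zero_pair]
    obtain ⟨c, hc⟩ := eq_const_of_dbar_eq_zero_one k d h₀' h₁'
    -- the constant is `d(z₀) = x(z₀) - y(z₀) = 0`
    have hval : sec₀ (1 : ℂ → ℂ) (⇊[k + 1] d) z₀ = 0 := by
      have hx := x.2
      have hy := y.2
      simp only [LinearMap.mem_ker, ContinuousLinearMap.coe_coe] at hx hy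
      have : eval₀CLM (F := ℂ) (1 : ℂ → ℂ) (k + 1) r z₀ d = 0 := by
        rw [hd_def, map_sub, hx, hy, sub_zero]
      rwa [eval₀CLM_eq_sec₀ hz₀] at this
    have hc0 : c = 0 := by rw [← hc z₀, hval]
    have hd0 : d = 0 := eq_zero_of_sec₀_eq_zero d fun z => by rw [hc z, hc0]
    exact sub_eq_zero.1 hd0
  · -- surjective: right inverse, corrected by a constant
    intro η
    obtain ⟨R, hR⟩ := exists_dbar_rightInverse_one (F := ℂ) k hr0 hr1
    set u := R η with hu
    obtain ⟨hR₀, hR₁⟩ := hR η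
    set c : ℂ := sec₀ (1 : ℂ → ℂ) (⇊[k + 1] u) z₀ with hc
    obtain ⟨p, hp₀, hp₁, hpd₀, hpd₁⟩ := exists_const (r := r) (k + 1) hr1.le c
    have hmem : u - p ∈ (eval₀CLM (F := ℂ) (1 : ℂ → ℂ) (k + 1) r z₀).ker := by
      rw [LinearMap.mem_ker, map_sub]
      change eval₀CLM (F := ℂ) 1 (k + 1) r z₀ u - eval₀CLM (F := ℂ) 1 (k + 1) r z₀ p = 0
      rw [eval₀CLM_eq_sec₀ hz₀, eval₀CLM_eq_sec₀ hz₀, hp₀, hc, sub_self]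
    refine ⟨⟨u - p, hmem⟩, ?_⟩
    show dbarOne hr1.le k (u - p) = η
    rw [map_sub]
    have hu' : dbarOne hr1.le k u = η := (dbarOne_eq_iff hr1 u η).2 ⟨hR₀, hR₁⟩
    have hp' : dbarOne hr1.le k p = 0 :=
      (dbarOne_eq_iff hr1 p 0).2 ⟨fun z => by rw [hpd₀ z, Submodule.coe_zero, sec₀_zero_pair],
        fun w => by rw [hpd₁ w, Submodule.coe_zero, sec₁_zero_pair]⟩
    rw [hu', hp', sub_zero]

end DbarBlock

/-! ### Chart formulas for the zeroth-order term and the equation -/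

section Main

variable (a₀ a₁ : ℂ → ℂ →L[ℝ] ℂ) (ha₀ : ContDiff ℝ ∞ a₀) (ha₁ : ContDiff ℝ ∞ a₁)
  (hcl : IsFormCoeff a₀ a₁)

/-- `∂̄` of a difference of functions differentiable at the point. [folklore] -/
theorem dbarAlong_one_sub {f g : ℂ → ℂ} {z : ℂ} (hf : DifferentiableAt ℝ f z)
    (hg : DifferentiableAt ℝ g z) :
    dbarAlong 1 (f - g) z = dbarAlong 1 f z - dbarAlong 1 g z := by
  simp only [dbarAlong, fderiv_sub hf hg, FunLike.coe_sub, Pi.sub_apply, smul_sub]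
  ring

/-- `sec₀` of a negated pair. [folklore] -/
theorem sec₀_neg_pair {j : ℕ} (τ : ℂ → ℂ) (p : ContDiffHolderFunction ℂ ℂ j r × ContDiffHolderFunction ℂ ℂ j r)
    (z : ℂ) : sec₀ τ (-p) z = -sec₀ τ p z := by
  by_cases hz : ‖z‖ < 2 <;> simp [sec₀, hz]

/-- `sec₁` of a negated pair. [folklore] -/
theorem sec₁_neg_pair {j : ℕ} (τ : ℂ → ℂ) (p : ContDiffHolderFunction ℂ ℂ j r × ContDiffHolderFunction ℂ ℂ j r)
    (w : ℂ) : sec₁ τ (-p) w = -sec₁ τ p w := by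
  by_cases hw : ‖w‖ < 2 <;> simp [sec₁, hw]

/-- `sec₁` of a difference of pairs. [folklore] -/
theorem sec₁_sub_pair {j : ℕ} (τ : ℂ → ℂ) (p q : ContDiffHolderFunction ℂ ℂ j r × ContDiffHolderFunction ℂ ℂ j r)
    (w : ℂ) : sec₁ τ (p - q) w = sec₁ τ p w - sec₁ τ q w := by
  by_cases hw : ‖w‖ < 2 <;> simp [sec₁, hw, mul_sub]

/-- Chart formula for `formMul`, `z`-chart. [cite: Wendl2018, §2.3] -/
theorem sec₀_formMul (hr : r ≤ 1) (k : ℕ) (p : holderSections ℂ (1 : ℂ → ℂ) k r) (z : ℂ) :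
    sec₀ (dbarClutch 1) (⇊[k] (formMul a₀ a₁ ha₀ ha₁ hcl hr k p)) z =
      a₀ z (sec₀ (1 : ℂ → ℂ) (⇊[k] p) z) :=
  sec₀_mulSec p z

/-- Chart formula for `formMul`, `w`-chart. [cite: Wendl2018, §2.3] -/
theorem sec₁_formMul (hr : r ≤ 1) (k : ℕ) (p : holderSections ℂ (1 : ℂ → ℂ) k r) (w : ℂ) :
    sec₁ (dbarClutch 1) (⇊[k] (formMul a₀ a₁ ha₀ ha₁ hcl hr k p)) w =
      a₁ w (sec₁ (1 : ℂ → ℂ) (⇊[k] p) w) :=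
  sec₁_mulSec p w

/-- **The equation `∂̄ x + A x = 0` chartwise**: `∂̄ (sec₀ x) = -a₀ · sec₀ x` and
`∂̄ (sec₁ x) = -a₁ · sec₁ x` on all of `ℂ`. [cite: Wendl2018, Thm. 2.46] -/
theorem chart_eq_of_dbar_add_formMul_eq_zero (hr1 : r < 1) (x : holderSections ℂ (1 : ℂ → ℂ) (k + 1) r)
    (h : dbarOne hr1.le k x + formMul a₀ a₁ ha₀ ha₁ hcl hr1.le k (inclCLM hr1.le x) = 0) :
    (∀ z : ℂ, dbarAlong 1 (sec₀ (1 : ℂ → ℂ) (⇊[k + 1] x)) z = -(a₀ z (sec₀ (1 : ℂ → ℂ) (⇊[k + 1] x) z))) ∧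
    (∀ w : ℂ, dbarAlong 1 (sec₁ (1 : ℂ → ℂ) (⇊[k + 1] x)) w = -(a₁ w (sec₁ (1 : ℂ → ℂ) (⇊[k + 1] x) w))) := by
  constructor
  · intro z
    have h0 := congrArg (fun q : holderSections ℂ (dbarClutch 1) k r => sec₀ (dbarClutch 1) (⇊[k] q) z) h
    simp only [Submodule.coe_add, sec₀_add, Submodule.coe_zero, sec₀_zero_pair] at h0
    rw [dbarOne, sec₀_dbarSec, sec₀_formMul, sec₀_inclCLM] at h0
    exact eq_neg_of_add_eq_zero_left h0
  · intro w
    have h0 := congrArg (fun q : holderSections ℂ (dbarClutch 1) k r => sec₁ (dbarClutch 1) (⇊[k] q) w) h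
    simp only [Submodule.coe_add, sec₁_add, Submodule.coe_zero, sec₁_zero_pair] at h0
    rw [dbarOne, sec₁_dbarSec, sec₁_formMul, sec₁_inclCLM] at h0
    exact eq_neg_of_add_eq_zero_left h0

/-! ### Bootstrapping: solutions are smooth -/

/-- The `w`-representative of a member of `𝓗¹` is the constant `c` if its `z`-representative is
(clutching for `w ≠ 0`, continuity at `w = 0`). [folklore] -/
theorem sec₁_eq_const_of_sec₀_eq_const {j : ℕ} (d : holderSections ℂ (1 : ℂ → ℂ) j r) {c : ℂ}
    (h : ∀ z : ℂ, sec₀ (1 : ℂ → ℂ) (⇊[j] d) z = c) : ∀ w : ℂ, sec₁ (1 : ℂ → ℂ) (⇊[j] d) w = c := by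
  have hne : ∀ w : ℂ, w ≠ 0 → sec₁ (1 : ℂ → ℂ) (⇊[j] d) w = c := fun w hw => by
    rw [sec₁_eq_smul_sec₀ d.2 one_clutch_ne_zero hw, h, Pi.one_apply, one_smul]
  intro w
  by_cases hw : w = 0
  · have hc : Continuous (sec₁ (1 : ℂ → ℂ) (⇊[j] d)) :=
      (contDiff_sec₁ d.2 (contDiffOn_real_of_differentiableOn differentiableOn_one_clutch)).continuous
    have hlim : Tendsto (sec₁ (1 : ℂ → ℂ) (⇊[j] d)) (𝓝[≠] 0) (𝓝 (sec₁ (1 : ℂ → ℂ) (⇊[j] d) 0)) :=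
      (hc.tendsto 0).mono_left nhdsWithin_le_nhds
    have hlim' : Tendsto (sec₁ (1 : ℂ → ℂ) (⇊[j] d)) (𝓝[≠] 0) (𝓝 c) :=
      tendsto_const_nhds.congr' (eventually_nhdsWithin_of_forall fun w hw => (hne w hw).symm)
    rw [hw]
    exact tendsto_nhds_unique hlim hlim'
  · exact hne w hw

/-- **Bootstrapping.** A solution `x ∈ 𝓗¹ₖ₊₁` of `∂̄ (sec x) = -a · sec x` in both charts has
representatives in `𝓗¹` of EVERY order: for every `m` there is `y ∈ 𝓗¹_{(k+m)+1}` with the same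
chart representatives (right inverse at level `k + m + 1`, kernel = constants). [cite: Wendl2018, Thm. 2.46] -/
theorem exists_rep_of_chart_eq (ha₀ : ContDiff ℝ ∞ a₀) (ha₁ : ContDiff ℝ ∞ a₁)
    (hcl : IsFormCoeff a₀ a₁) (hr0 : 0 < r) (hr1 : r < 1) (x : holderSections ℂ (1 : ℂ → ℂ) (k + 1) r)
    (h₀ : ∀ z : ℂ, dbarAlong 1 (sec₀ (1 : ℂ → ℂ) (⇊[k + 1] x)) z = -(a₀ z (sec₀ (1 : ℂ → ℂ) (⇊[k + 1] x) z)))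
    (h₁ : ∀ w : ℂ, dbarAlong 1 (sec₁ (1 : ℂ → ℂ) (⇊[k + 1] x)) w = -(a₁ w (sec₁ (1 : ℂ → ℂ) (⇊[k + 1] x) w)))
    (m : ℕ) :
    ∃ y : holderSections ℂ (1 : ℂ → ℂ) ((k + m) + 1) r,
      (∀ z : ℂ, sec₀ (1 : ℂ → ℂ) (⇊[(k + m) + 1] y) z = sec₀ (1 : ℂ → ℂ) (⇊[k + 1] x) z) ∧
      (∀ w : ℂ, sec₁ (1 : ℂ → ℂ) (⇊[(k + m) + 1] y) w = sec₁ (1 : ℂ → ℂ) (⇊[k + 1] x) w) := by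
  induction m with
  | zero => exact ⟨x, fun z => rfl, fun w => rfl⟩
  | succ m ih =>
    obtain ⟨y, hy₀, hy₁⟩ := ih
    -- `η' := A y` at level `k + m + 1`, and `u := R (-η')` at level `k + m + 2`
    set η' : holderSections ℂ (dbarClutch 1) ((k + m) + 1) r :=
      formMul a₀ a₁ ha₀ ha₁ hcl hr1.le ((k + m) + 1) y with hη'
    obtain ⟨R, hR⟩ := exists_dbar_rightInverse_one (F := ℂ) ((k + m) + 1) hr0 hr1
    set u : holderSections ℂ (1 : ℂ → ℂ) (((k + m) + 1) + 1) r := R (-η') with hu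
    obtain ⟨hu₀, hu₁⟩ := hR (-η')
    have hsec₀η : ∀ z, sec₀ (dbarClutch 1)
        (((-η' : holderSections ℂ (dbarClutch 1) ((k + m) + 1) r) :
          ContDiffHolderFunction ℂ ℂ ((k + m) + 1) r × ContDiffHolderFunction ℂ ℂ ((k + m) + 1) r)) z =
        -(a₀ z (sec₀ (1 : ℂ → ℂ) (⇊[k + 1] x) z)) := by
      intro z
      rw [Submodule.coe_neg, sec₀_neg_pair, hη', sec₀_formMul, hy₀]
    have hsec₁η : ∀ w, sec₁ (dbarClutch 1)
        (((-η' : holderSections ℂ (dbarClutch 1) ((k + m) + 1) r) :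
          ContDiffHolderFunction ℂ ℂ ((k + m) + 1) r × ContDiffHolderFunction ℂ ℂ ((k + m) + 1) r)) w =
        -(a₁ w (sec₁ (1 : ℂ → ℂ) (⇊[k + 1] x) w)) := by
      intro w
      rw [Submodule.coe_neg, sec₁_neg_pair, hη', sec₁_formMul, hy₁]
    -- `d := incl u - y` has `∂̄ = 0` in both charts, hence is a constant `c`
    set d : holderSections ℂ (1 : ℂ → ℂ) ((k + m) + 1) r := inclCLM hr1.le u - y with hd
    have hdiffu : ∀ z, DifferentiableAt ℝ (sec₀ (1 : ℂ → ℂ) (⇊[((k + m) + 1) + 1] u)) z := fun z =>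
      ((contDiff_sec₀ u.2 one_clutch_ne_zero (contDiffOn_real_of_differentiableOn
        differentiableOn_one_clutch)).differentiable (by simp)).differentiableAt
    have hdiffx : ∀ z, DifferentiableAt ℝ (sec₀ (1 : ℂ → ℂ) (⇊[k + 1] x)) z := fun z =>
      ((contDiff_sec₀ x.2 one_clutch_ne_zero (contDiffOn_real_of_differentiableOn
        differentiableOn_one_clutch)).differentiable (by simp)).differentiableAt
    have hdiffu' : ∀ w, DifferentiableAt ℝ (sec₁ (1 : ℂ → ℂ) (⇊[((k + m) + 1) + 1] u)) w := fun w =>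
      ((contDiff_sec₁ u.2 (contDiffOn_real_of_differentiableOn
        differentiableOn_one_clutch)).differentiable (by simp)).differentiableAt
    have hdiffx' : ∀ w, DifferentiableAt ℝ (sec₁ (1 : ℂ → ℂ) (⇊[k + 1] x)) w := fun w =>
      ((contDiff_sec₁ x.2 (contDiffOn_real_of_differentiableOn
        differentiableOn_one_clutch)).differentiable (by simp)).differentiableAt
    have hd₀ : ∀ z, sec₀ (1 : ℂ → ℂ) (⇊[(k + m) + 1] d) z =
        sec₀ (1 : ℂ → ℂ) (⇊[((k + m) + 1) + 1] u) z - sec₀ (1 : ℂ → ℂ) (⇊[k + 1] x) z := by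
      intro z
      rw [hd, Submodule.coe_sub, sec₀_sub, sec₀_inclCLM, hy₀]
    have hd₁ : ∀ w, sec₁ (1 : ℂ → ℂ) (⇊[(k + m) + 1] d) w =
        sec₁ (1 : ℂ → ℂ) (⇊[((k + m) + 1) + 1] u) w - sec₁ (1 : ℂ → ℂ) (⇊[k + 1] x) w := by
      intro w
      rw [hd, Submodule.coe_sub, sec₁_sub_pair, sec₁_inclCLM, hy₁]
    have hd₀f : sec₀ (1 : ℂ → ℂ) (⇊[(k + m) + 1] d) =
        sec₀ (1 : ℂ → ℂ) (⇊[((k + m) + 1) + 1] u) - sec₀ (1 : ℂ → ℂ) (⇊[k + 1] x) := funext hd₀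
    have hd₁f : sec₁ (1 : ℂ → ℂ) (⇊[(k + m) + 1] d) =
        sec₁ (1 : ℂ → ℂ) (⇊[((k + m) + 1) + 1] u) - sec₁ (1 : ℂ → ℂ) (⇊[k + 1] x) := funext hd₁
    have hdz₀ : ∀ z, dbarAlong 1 (sec₀ (1 : ℂ → ℂ) (⇊[(k + m) + 1] d)) z = 0 := fun z => by
      rw [hd₀f, dbarAlong_one_sub (hdiffu z) (hdiffx z), hu₀ z, hsec₀η, h₀, sub_self]
    have hdz₁ : ∀ w, dbarAlong 1 (sec₁ (1 : ℂ → ℂ) (⇊[(k + m) + 1] d)) w = 0 := fun w => by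
      rw [hd₁f, dbarAlong_one_sub (hdiffu' w) (hdiffx' w), hu₁ w, hsec₁η, h₁, sub_self]
    obtain ⟨c, hc⟩ := eq_const_of_dbar_eq_zero_one (k + m) d hdz₀ hdz₁
    have hc₁ := sec₁_eq_const_of_sec₀_eq_const d hc
    -- correct `u` by the constant
    obtain ⟨p, hp₀, hp₁, -, -⟩ := exists_const (r := r) (((k + m) + 1) + 1) hr1.le c
    refine ⟨u - p, fun z => ?_, fun w => ?_⟩
    · rw [Submodule.coe_sub, sec₀_sub, hp₀]
      have := hc z
      rw [hd₀] at this
      linear_combination this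
    · rw [Submodule.coe_sub, sec₁_sub_pair, hp₁]
      have := hc₁ w
      rw [hd₁] at this
      linear_combination this

/-- **Regularity**: the representatives of such a solution are `C^∞`. [cite: Wendl2018, Thm. 2.46] -/
theorem contDiff_sec_of_chart_eq (ha₀ : ContDiff ℝ ∞ a₀) (ha₁ : ContDiff ℝ ∞ a₁)
    (hcl : IsFormCoeff a₀ a₁) (hr0 : 0 < r) (hr1 : r < 1) (x : holderSections ℂ (1 : ℂ → ℂ) (k + 1) r)
    (h₀ : ∀ z : ℂ, dbarAlong 1 (sec₀ (1 : ℂ → ℂ) (⇊[k + 1] x)) z = -(a₀ z (sec₀ (1 : ℂ → ℂ) (⇊[k + 1] x) z)))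
    (h₁ : ∀ w : ℂ, dbarAlong 1 (sec₁ (1 : ℂ → ℂ) (⇊[k + 1] x)) w = -(a₁ w (sec₁ (1 : ℂ → ℂ) (⇊[k + 1] x) w))) :
    ContDiff ℝ ∞ (sec₀ (1 : ℂ → ℂ) (⇊[k + 1] x)) ∧ ContDiff ℝ ∞ (sec₁ (1 : ℂ → ℂ) (⇊[k + 1] x)) := by
  constructor
  · refine contDiff_infty.2 fun n => ?_
    obtain ⟨y, hy₀, -⟩ := exists_rep_of_chart_eq a₀ a₁ ha₀ ha₁ hcl hr0 hr1 x h₀ h₁ n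
    have hy : ContDiff ℝ ((k + n) + 1 : ℕ) (sec₀ (1 : ℂ → ℂ) (⇊[(k + n) + 1] y)) :=
      contDiff_sec₀ y.2 one_clutch_ne_zero (contDiffOn_real_of_differentiableOn differentiableOn_one_clutch)
    rw [show sec₀ (1 : ℂ → ℂ) (⇊[k + 1] x) = sec₀ (1 : ℂ → ℂ) (⇊[(k + n) + 1] y) from
      funext fun z => (hy₀ z).symm]
    exact hy.of_le (by exact_mod_cast (by omega : n ≤ (k + n) + 1))
  · refine contDiff_infty.2 fun n => ?_
    obtain ⟨y, -, hy₁⟩ := exists_rep_of_chart_eq a₀ a₁ ha₀ ha₁ hcl hr0 hr1 x h₀ h₁ n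
    have hy : ContDiff ℝ ((k + n) + 1 : ℕ) (sec₁ (1 : ℂ → ℂ) (⇊[(k + n) + 1] y)) :=
      contDiff_sec₁ y.2 (contDiffOn_real_of_differentiableOn differentiableOn_one_clutch)
    rw [show sec₁ (1 : ℂ → ℂ) (⇊[k + 1] x) = sec₁ (1 : ℂ → ℂ) (⇊[(k + n) + 1] y) from
      funext fun w => (hy₁ w).symm]
    exact hy.of_le (by exact_mod_cast (by omega : n ≤ (k + n) + 1))

/-! ### The kernel element vanishing at a point vanishes -/

/-- **`hinj`**: a solution of `∂̄ x + A x = 0` in `𝓗¹ₖ₊₁` vanishing at `z₀` (`‖z₀‖ < 2`) is zero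
(smoothness + the Cauchy–Riemann inequality in both charts + the similarity principle on the
sphere with `c₁ = 0`). [cite: Wendl2018, Prop. 2.47] -/
theorem eq_zero_of_dbar_add_formMul_eq_zero (hr0 : 0 < r) (hr1 : r < 1) {z₀ : ℂ} (hz₀ : ‖z₀‖ < 2)
    (x : holderSections ℂ (1 : ℂ → ℂ) (k + 1) r)
    (hx0 : eval₀CLM (F := ℂ) (1 : ℂ → ℂ) (k + 1) r z₀ x = 0)
    (h : dbarOne hr1.le k x + formMul a₀ a₁ ha₀ ha₁ hcl hr1.le k (inclCLM hr1.le x) = 0) : x = 0 := by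
  obtain ⟨h₀, h₁⟩ := chart_eq_of_dbar_add_formMul_eq_zero a₀ a₁ ha₀ ha₁ hcl hr1 x h
  obtain ⟨hs₀, hs₁⟩ := contDiff_sec_of_chart_eq a₀ a₁ ha₀ ha₁ hcl hr0 hr1 x h₀ h₁
  -- bounds for the coefficients on the closed disc of radius 3
  obtain ⟨M₀, hM₀⟩ := (isCompact_closedBall (0 : ℂ) 3).exists_bound_of_continuousOn
    (ha₀.continuous.continuousOn)
  obtain ⟨M₁, hM₁⟩ := (isCompact_closedBall (0 : ℂ) 3).exists_bound_of_continuousOn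
    (ha₁.continuous.continuousOn)
  set M := max M₀ M₁ with hM
  have hb₀ : ∀ z : ℂ, ‖z‖ < 3 → ‖dbarAlong 1 (sec₀ (1 : ℂ → ℂ) (⇊[k + 1] x)) z‖ ≤
      M * ‖sec₀ (1 : ℂ → ℂ) (⇊[k + 1] x) z‖ := by
    intro z hz
    rw [h₀ z, norm_neg]
    calc ‖a₀ z (sec₀ (1 : ℂ → ℂ) (⇊[k + 1] x) z)‖
        ≤ ‖a₀ z‖ * ‖sec₀ (1 : ℂ → ℂ) (⇊[k + 1] x) z‖ := ContinuousLinearMap.le_opNorm _ _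
      _ ≤ M * ‖sec₀ (1 : ℂ → ℂ) (⇊[k + 1] x) z‖ := by
          gcongr
          exact (hM₀ z (mem_closedBall_zero_iff.2 hz.le)).trans (le_max_left _ _)
  have hb₁ : ∀ w : ℂ, ‖w‖ < 3 → ‖dbarAlong 1 (sec₁ (1 : ℂ → ℂ) (⇊[k + 1] x)) w‖ ≤
      M * ‖sec₁ (1 : ℂ → ℂ) (⇊[k + 1] x) w‖ := by
    intro w hw
    rw [h₁ w, norm_neg]
    calc ‖a₁ w (sec₁ (1 : ℂ → ℂ) (⇊[k + 1] x) w)‖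
        ≤ ‖a₁ w‖ * ‖sec₁ (1 : ℂ → ℂ) (⇊[k + 1] x) w‖ := ContinuousLinearMap.le_opNorm _ _
      _ ≤ M * ‖sec₁ (1 : ℂ → ℂ) (⇊[k + 1] x) w‖ := by
          gcongr
          exact (hM₁ w (mem_closedBall_zero_iff.2 hw.le)).trans (le_max_right _ _)
  have hrel : ∀ w : ℂ, w ≠ 0 → sec₁ (1 : ℂ → ℂ) (⇊[k + 1] x) w = sec₀ (1 : ℂ → ℂ) (⇊[k + 1] x) w⁻¹ :=
    fun w hw => by rw [sec₁_eq_smul_sec₀ x.2 one_clutch_ne_zero hw, Pi.one_apply, one_smul]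
  rcases zero_or_forall_ne_zero_of_dbar_le _ _ M hs₀ hs₁ hrel hb₀ hb₁ with hz | ⟨hnz, -⟩
  · exact eq_zero_of_sec₀_eq_zero x hz
  · exfalso
    apply hnz z₀
    rwa [eval₀CLM_eq_sec₀ hz₀] at hx0

/-! ### The main theorem -/

/-- **Automatic transversality for `∂̄ + A` on functions over `S²`** (`c₁ = 0`, `g = 0`): for
`‖z₀‖ < 2` the map `f ↦ (∂̄ f + A f, f(z₀))` is a bijection `𝓗¹ₖ₊₁ → 𝓗⁰ₖ × ℂ`. Hence `∂̄ + A` is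
onto and its kernel is 2-dimensional, detected by evaluation at a point.
[cite: Wendl2018, Thm. 2.46] -/
theorem bijective_dbar_add_formMul_prod_eval (hr0 : 0 < r) (hr1 : r < 1) (k : ℕ) {z₀ : ℂ}
    (hz₀ : ‖z₀‖ < 2) :
    Bijective fun f : holderSections ℂ (1 : ℂ → ℂ) (k + 1) r =>
      ((dbarOne hr1.le k + (formMul a₀ a₁ ha₀ ha₁ hcl hr1.le k).comp (inclCLM hr1.le)) f,
        eval₀CLM (F := ℂ) (1 : ℂ → ℂ) (k + 1) r z₀ f) := by
  haveI : FiniteDimensional ℂ ℂ := inferInstance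
  refine Literature.Analysis.Calculus.bijective_prod_of_isCompactOperator (dbarOne hr1.le k)
    ((formMul a₀ a₁ ha₀ ha₁ hcl hr1.le k).comp (inclCLM hr1.le))
    (eval₀CLM (F := ℂ) (1 : ℂ → ℂ) (k + 1) r z₀) ?_ ?_ ?_ ?_
  · -- `hℓ`: constants
    intro c
    obtain ⟨p, hp₀, -, -, -⟩ := exists_const (r := r) (k + 1) hr1.le c
    exact ⟨p, by rw [eval₀CLM_eq_sec₀ hz₀, hp₀]⟩
  · exact bijective_dbarOne_ker_eval hr0 hr1 k hz₀
  · exact isCompactOperator_mulSec_comp_inclCLM _ _ _ hr0 hr1.le _ _ _ _ _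
  · intro x hx h
    refine eq_zero_of_dbar_add_formMul_eq_zero a₀ a₁ ha₀ ha₁ hcl hr0 hr1 hz₀ x hx ?_
    simpa only [FunLike.coe_add, Pi.add_apply, ContinuousLinearMap.coe_comp,
      Function.comp_apply] using h

/-- **Corollary: `∂̄ + A` is onto.** [cite: Wendl2018, Thm. 2.46] -/
theorem surjective_dbar_add_formMul (hr0 : 0 < r) (hr1 : r < 1) (k : ℕ) :
    Surjective (dbarOne hr1.le k + (formMul a₀ a₁ ha₀ ha₁ hcl hr1.le k).comp (inclCLM hr1.le)) := by
  intro η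
  obtain ⟨f, hf⟩ := (bijective_dbar_add_formMul_prod_eval a₀ a₁ ha₀ ha₁ hcl hr0 hr1 k
    (z₀ := 0) (by simp)).2 (η, 0)
  exact ⟨f, congrArg Prod.fst hf⟩

/-- **The bordered inverse** `(∂̄ + A, ev_{z₀})⁻¹ : 𝓗⁰ₖ × ℂ ≃L 𝓗¹ₖ₊₁` (Banach open mapping).
[cite: Wendl2018, Thm. 2.46] -/
def atEquiv (hr0 : 0 < r) (hr1 : r < 1) (k : ℕ) {z₀ : ℂ} (hz₀ : ‖z₀‖ < 2) :
    holderSections ℂ (1 : ℂ → ℂ) (k + 1) r ≃L[ℝ] holderSections ℂ (dbarClutch 1) k r × ℂ :=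
  ContinuousLinearEquiv.ofBijective
    ((dbarOne hr1.le k + (formMul a₀ a₁ ha₀ ha₁ hcl hr1.le k).comp (inclCLM hr1.le)).prod
      (eval₀CLM (F := ℂ) (1 : ℂ → ℂ) (k + 1) r z₀))
    (LinearMap.ker_eq_bot.2 (bijective_dbar_add_formMul_prod_eval a₀ a₁ ha₀ ha₁ hcl hr0 hr1 k hz₀).1)
    (LinearMap.range_eq_top.2 (bijective_dbar_add_formMul_prod_eval a₀ a₁ ha₀ ha₁ hcl hr0 hr1 k hz₀).2)

/-- The bordered equivalence applied. [folklore] -/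
@[simp] theorem atEquiv_apply (hr0 : 0 < r) (hr1 : r < 1) (k : ℕ) {z₀ : ℂ} (hz₀ : ‖z₀‖ < 2)
    (f : holderSections ℂ (1 : ℂ → ℂ) (k + 1) r) :
    atEquiv a₀ a₁ ha₀ ha₁ hcl hr0 hr1 k hz₀ f =
      ((dbarOne hr1.le k + (formMul a₀ a₁ ha₀ ha₁ hcl hr1.le k).comp (inclCLM hr1.le)) f,
        eval₀CLM (F := ℂ) (1 : ℂ → ℂ) (k + 1) r z₀ f) := rfl

end Main

end RiemannSphere

end Literature.Analysis.Complex

end
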